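import Summits.BirchSwinnertonDyer.Rank1Residual.P2.CongruentNumberThetaCriterion
import Summits.BirchSwinnertonDyer.Rank1Residual.P2.CongruentNumberSilentEvenFiveThetaRecursion
import Summits.BirchSwinnertonDyer.Rank1Residual.P2.CongruentNumberSilentEvenFiveGenusParity
import Summits.BirchSwinnertonDyer.Rank1Residual.P2.CongruentNumberSilentEvenFiveAokiSymbols
import HarnessLib
import HarnessLib.Audit.Tags

/-!
# Cell «bsd-monsky» (prover-B): the UNIFORM Θ-criterion at `k = 2` — THEOREM B (`n = 2pq`, `p ≡ 5 (mod 8)`, `q ≡ 3 (mod 4)`)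
# is an INSTANCE: `2pq` is `θ`-controlled and `Θ(2pq) = g(2pq)` (consistency check of the general theorem against the
# refereed `k = 2` route; kernel theorem, nothing asserted, nothing booked)

HONEST FRAMING (cell `bsd-monsky`, run/shared/lean/pub/bsd-monsky/; README §1/§3). The cell's CLAIMED theorem (Monsky 1990 on
`𝒮⁻`) is refereed as PROOF-B v1.3 and enclosed as `P2/CongruentNumberSilentEvenFiveTheta*.lean` (route B). THIS FILE re-derives
route B's THEOREM B («`g(2pq)` odd ⟹ `𝓛(2pq)` odd») from the UNIFORM Θ-criterion `ThetaDescent.odd_scriptL_of_thetaCert`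
(`P2/CongruentNumberThetaCriterion.lean`, this generation; ALL square-free `n ≡ 6 (mod 8)`): for `n = 2pq` the control
condition holds (the `7`-block with cofactor `≡ 2` is `pq` or `q`, whose only `5`-divisor is the prime `p ≡ 1 (mod 4)`) and
the Θ-certificate is the constant `g(2pq)` (the only `6`-block with cofactor `≡ 1 (mod 8)` is `n` itself, and `R(n) = {pq}`
or `{q}` has no `6`-block). It is a CONSISTENCY CHECK of the general theorem against the refereed `k = 2` argument — the
conclusions coincide with `…ThetaDescent.lean` / `…GenusParity.lean` (nothing new is claimed at `k = 2`). CONDITIONAL on TYZ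
data with the displayed sentences (`tyz_cmPointGaloisData`); nothing asserted; no count moves.

References: [TianYuanZhang2017] §3.1 (p0011 L67–L73), Prop. 3.2, Thm. 3.5, Thm. 3.6 (J741), proof of Lemma 3.21 (J759);
HOME/proof/PROOF-B.md v1.3 §4–§8; HOME/proof/PROOF-B-THETA-CRITERION.md.
-/

noncomputable section

open scoped Classical

open WeierstrassCurve WeierstrassCurve.Affine Literature.NumberTheory.EllipticCurves
  Literature.NumberTheory.EllipticCurves.Rank1Residual
  Literature.NumberTheory.EllipticCurves.Rank1Residual.Typed
  Literature.NumberTheory.EllipticCurves.TianYuanZhang2017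
  Literature.NumberTheory.EllipticCurves.TianYuanZhang2017.W2

set_option autoImplicit false

namespace Summit.BirchSwinnertonDyer.Rank1Residual.P2

namespace ThetaDescent

variable {p q : ℕ}

/-- For `n = 2pq` (`p ≡ 5 (mod 8)`, `q ≡ 3 (mod 4)` primes) the only divisor `≡ 5 (mod 8)` is `p`, whose prime factors are
`≡ 1 (mod 4)`: every `5`-divisor of `2pq` is GOOD. [cite: TianYuanZhang2017, §3.1 (p0011 L67–L70)] -/
theorem fiveGood_of_dvd_two_mul_five_mul (hp : p.Prime) (hq : q.Prime) (hp5 : p % 8 = 5) (hq4 : q % 4 = 3) {d' : ℕ}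
    (hd' : d' ∣ 2 * (p * q)) (h5 : d' % 8 = 5) : ∀ r ∈ d'.primeFactors, r % 4 = 1 := by
  have hpq : (p * q) % 4 = 3 := by rw [Nat.mul_mod, show p % 4 = 1 by omega, hq4]
  have hd'' : d' ∣ 2 * p * q := by rwa [mul_assoc]
  have h2 : 2 ∣ 2 * p * q := ⟨p * q, by ring⟩
  rcases (dvd_mul_three_iff Nat.prime_two hp hq).mp hd'' with rfl | rfl | rfl | rfl | rfl | rfl | rfl | rfl
  · omega
  · omega
  · intro r hr
    rw [hp.primeFactors, Finset.mem_singleton] at hr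
    omega
  · omega
  · omega
  · omega
  · omega
  · omega

/-- **`2pq` is `θ`-controlled** (`p ≡ 5 (mod 8)`, `q ≡ 3 (mod 4)`): every `7`-block of `2pq` with cofactor `≡ 2 (mod 8)` (`pq`
if `q ≡ 3`, `q` if `q ≡ 7 (mod 8)`) has only good `5`-divisors (namely `p`). [cite: TianYuanZhang2017, §3.1 (p0011 L67–L70)] -/
theorem thetaControlled_two_mul_five_mul (hp : p.Prime) (hq : q.Prime) (hp5 : p % 8 = 5) (hq4 : q % 4 = 3) :
    ∀ d₀ ∈ (2 * (p * q)).divisors, d₀ % 8 = 7 → (2 * (p * q) / d₀) % 8 = 2 → ∀ d' ∈ d₀.divisors, d' % 8 = 5 →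
      ∀ r ∈ d'.primeFactors, r % 4 = 1 := fun _ hd₀ _ _ _ hd' h5 =>
  fiveGood_of_dvd_two_mul_five_mul hp hq hp5 hq4 ((Nat.mem_divisors.mp hd').1.trans (Nat.mem_divisors.mp hd₀).1) h5

/-- **The Θ-certificate of `2pq` is the constant `g(2pq)`**: the only `6`-block `e ∣ 2pq` with cofactor `≡ 1 (mod 8)` is
`2pq` itself, and `R(2pq) = {pq}` or `{q}` contains no `6`-block, so `Θ(2pq) = g(2pq)`.
[cite: TianYuanZhang2017, §3.1 (p0011 L67–L73)] -/
theorem thetaCert_two_mul_five_mul (hp : p.Prime) (hq : q.Prime) (hp5 : p % 8 = 5) (hq4 : q % 4 = 3)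
    (D : GenusPointData (2 * (p * q))) :
    ∀ e ∈ (2 * (p * q)).divisors, e % 8 = 6 → (2 * (p * q) / e) % 8 = 1 →
      (fun _ : ℕ => (gK (2 * (p * q)) : ZMod 2)) e = (gK e : ZMod 2) +
        ∑ d₀ ∈ (recursionIndex e).filter (fun d₀ => d₀ % 8 = 6),
          (D.scriptL (e / d₀) : ZMod 2) * (fun _ : ℕ => (gK (2 * (p * q)) : ZMod 2)) d₀ := by
  intro e he he6 hq1
  have hpq : (p * q) % 4 = 3 := by rw [Nat.mul_mod, show p % 4 = 1 by omega, hq4]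
  have e2q : 2 * (p * q) / (2 * q) = p := by
    rw [show 2 * (p * q) = (2 * q) * p by ring]; exact Nat.mul_div_cancel_left p (by omega)
  -- `e = 2pq`
  have hen : e = 2 * (p * q) := by
    have he' : e ∣ 2 * p * q := by rw [mul_assoc]; exact (Nat.mem_divisors.mp he).1
    rcases (dvd_mul_three_iff Nat.prime_two hp hq).mp he' with rfl | rfl | rfl | rfl | rfl | rfl | rfl | rfl
    · omega
    · omega
    · omega
    · omega
    · omega
    · rw [e2q] at hq1; omega
    · omega
    · ring
  subst hen
  -- `R(2pq)` has no `6`-block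
  have hfilter : (recursionIndex (2 * (p * q))).filter (fun d₀ => d₀ % 8 = 6) = ∅ := by
    rw [recursionIndex_two_mul_five_mul hp hq hp5 hq4]
    split_ifs with h3
    · rw [Finset.filter_singleton, if_neg]
      omega
    · rw [Finset.filter_singleton, if_neg]
      omega
  simp only [hfilter, Finset.sum_empty, add_zero]

/-- **THEOREM B recovered from the uniform Θ-criterion** (`k = 2`): for primes `p ≡ 5 (mod 8)`, `q ≡ 3 (mod 4)`, TYZ data `D` for
`2pq` with the displayed sentences and rank `E(ℚ) ≤ 1` once `𝓛 ≠ 0`: `g(2pq)` odd ⟹ `𝓛(2pq)` odd. (Same conclusion as the refereed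
route B, `…ThetaDescent.lean`; here as the instance `Θ(2pq) = g(2pq)` of `odd_scriptL_of_thetaCert`.)
[cite: TianYuanZhang2017, Thm. 3.5 (p0011 L94–L112), Thm. 3.6 (2) (J741), §3.1 (p0011 L67–L73), proof of Lemma 3.21 (J759)] -/
theorem odd_scriptL_two_mul_five_mul_of_thetaCert (hp : p.Prime) (hq : q.Prime) (hp5 : p % 8 = 5) (hq4 : q % 4 = 3)
    (D : GenusPointData (2 * (p * q))) (hD : D.Printed) (hG : D.CMPointGaloisPrinted)
    (hr :
      letI := isElliptic_congruentNumberCurve (isCor515Family_two_mul_five_mul' hp hq hp5 hq4).squarefree.ne_zero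
      D.scriptL (2 * (p * q)) ≠ 0 → (congruentNumberCurve (2 * (p * q))).mordellWeilRank ≤ 1)
    (hg : Odd (gK (2 * (p * q)))) : Odd (D.scriptL (2 * (p * q))) :=
  odd_scriptL_of_thetaCert (isCor515Family_two_mul_five_mul' hp hq hp5 hq4).squarefree
    (two_mul_five_mul_mod_eight hp5 hq4) D hD hG hr
    (thetaControlled_two_mul_five_mul hp hq hp5 hq4) (fun _ => (gK (2 * (p * q)) : ZMod 2))
    (thetaCert_two_mul_five_mul hp hq hp5 hq4 D) (ZMod.natCast_eq_one_iff_odd.mpr hg)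

/-- **Clause (a) on `𝒮⁻` (and on the `q ≡ 3 (mod 8)` half) through the uniform Θ-criterion, from the display ALONE**:
`ord_{s=1} L(E_{2pq}, s) = 1` whenever `g(2pq)` is odd, i.e. `(q/p) = −1` or `q ≡ 3 (mod 8)` (Rédei–Reichardt, a tree theorem).
Same statement as `analyticRank_eq_one_sMinus_of_cmPointGaloisData` (route B); CONDITIONAL on `tyz_cmPointGaloisData`; nothing
asserted. [cite: TianYuanZhang2017, §1 (p0002 L46–L75), §3] -/
theorem analyticRank_eq_one_two_mul_five_mul_of_thetaCert (hCM : tyz_cmPointGaloisData) (hp : p.Prime) (hq : q.Prime)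
    (hp5 : p % 8 = 5) (hq4 : q % 4 = 3) (hpq : jacobiSym p q = -1 ∨ q % 8 = 3) :
    (congruentNumberCurve (2 * (p * q))).analyticRank = 1 :=
  analyticRank_eq_one_of_thetaCert_of_cmPointGaloisData hCM (isCor515Family_two_mul_five_mul' hp hq hp5 hq4).squarefree
    (two_mul_five_mul_mod_eight hp5 hq4) (thetaControlled_two_mul_five_mul hp hq hp5 hq4) fun D _ _ =>
    ⟨fun _ => (gK (2 * (p * q)) : ZMod 2), thetaCert_two_mul_five_mul hp hq hp5 hq4 D,
      ZMod.natCast_eq_one_iff_odd.mpr (odd_gK_two_mul_five_mul hp hq hp5 hq4 hpq)⟩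

end ThetaDescent

end Summit.BirchSwinnertonDyer.Rank1Residual.P2

end
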